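import Summits.Ventures.PercRepro.RankLevelSetLevelNineArithCubeAU
import Summits.Ventures.PercRepro.RankLevelSetLevelNineArithCubeAV
import Summits.Ventures.PercRepro.RankLevelSetLevelNineArithCubeAW
import Summits.Ventures.PercRepro.RankLevelSetLevelNineArithCubeAX
import Summits.Ventures.PercRepro.RankLevelSetLevelNineArithCubeAY
import Summits.Ventures.PercRepro.RankLevelSetLevelNineArithCubeAZ
import Summits.Ventures.PercRepro.RankLevelSetLevelNineArithCubeBA
import Summits.Ventures.PercRepro.RankLevelSetLevelNineArithCubeBB
import Summits.Ventures.PercRepro.RankLevelSetLevelNineArithCubeBC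
import Summits.Ventures.PercRepro.RankLevelSetLevelNineArithCubeBD

/-!
# PercRepro — THE LEVEL-`9` DISPATCHER OF THE PARTITION CHAIN WITH THE CUBIC MULTIPLICITY, PART ZC: `(P_d)` for `170 ≤ d ≤ 249`,
`p ≥ 381` (p4, gen 16; a feeder for S4). Axioms: standard.
-/

namespace PercRepro

namespace ThmN

/-- `(P_d)` at level `9` for `170 ≤ d ≤ 249`, `p ≥ 381`, in `ℚ`. -/
theorem level_nine_poly_cube_ZC (d : ℕ) (hd1 : 170 ≤ d) (hd2 : d ≤ 249) (p : ℕ) (hp : 381 ≤ p) :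
    8 * ((((p + d).choose 9 : ℕ) : ℚ) + (∑ j ∈ Finset.range (d - 9), ((Nat.choose (min 309 (max ((d + min 151 d) / 2 + 1) (min 150 (d - 1) + 2) - 2)) j : ℕ) : ℚ) / (((j + 1) + 3 * (j + 1).choose 2 + 3 * (j + 1).choose 3 : ℕ) : ℚ)) *
      (((d * (d + 1) / 2 : ℕ) : ℚ) * ((p + d).choose 7 : ℚ) + ((d * (d + 1) * (d + 2) / 3 : ℕ) : ℚ) * ((p + d).choose 6 : ℚ) + (((d + 4).choose 5 : ℕ) : ℚ) * ((p + d).choose 5 : ℚ) + (((d + 5).choose 6 : ℕ) : ℚ) * ((p + d).choose 4 : ℚ) + (((d + 6).choose 7 : ℕ) : ℚ) * ((p + d).choose 3 : ℚ) + (((d + 7).choose 8 : ℕ) : ℚ) * ((p + d).choose 2 : ℚ) + (((d + 8).choose 9 : ℕ) : ℚ) * (p + d : ℚ) + (((d + 9).choose 10 : ℕ) : ℚ)) +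
      ((∑ j ∈ Finset.range (d - 9), ((Nat.choose (min 319 (9 + d) - 10) j : ℕ) : ℚ) / (((j + 1) + 3 * (j + 1).choose 2 + 3 * (j + 1).choose 3 : ℕ) : ℚ)) - (∑ j ∈ Finset.range (d - 9), ((Nat.choose (min 150 (d - 1)) j : ℕ) : ℚ) / (((j + 1) + 3 * (j + 1).choose 2 + 3 * (j + 1).choose 3 : ℕ) : ℚ))) *
      ((d * (d + 1) / 2 * (min 319 (9 + d)).choose 7 + d * (d + 1) * (d + 2) / 3 * (min 319 (9 + d)).choose 6 + (d + 4).choose 5 * (min 319 (9 + d)).choose 5 + (d + 5).choose 6 * (min 319 (9 + d)).choose 4 + (d + 6).choose 7 * (min 319 (9 + d)).choose 3 + (d + 7).choose 8 * (min 319 (9 + d)).choose 2 + (d + 8).choose 9 * (min 319 (9 + d)) + (d + 9).choose 10 : ℕ) : ℚ)) ≤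
      7 * 2 ^ (d - 9) * (((p + 9).choose 9 : ℕ) : ℚ) := by
  interval_cases d
  · exact level_nine_poly_cube_170 p hp
  · exact level_nine_poly_cube_171 p hp
  · exact level_nine_poly_cube_172 p hp
  · exact level_nine_poly_cube_173 p hp
  · exact level_nine_poly_cube_174 p hp
  · exact level_nine_poly_cube_175 p hp
  · exact level_nine_poly_cube_176 p hp
  · exact level_nine_poly_cube_177 p hp
  · exact level_nine_poly_cube_178 p hp
  · exact level_nine_poly_cube_179 p hp
  · exact level_nine_poly_cube_180 p hp
  · exact level_nine_poly_cube_181 p hp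
  · exact level_nine_poly_cube_182 p hp
  · exact level_nine_poly_cube_183 p hp
  · exact level_nine_poly_cube_184 p hp
  · exact level_nine_poly_cube_185 p hp
  · exact level_nine_poly_cube_186 p hp
  · exact level_nine_poly_cube_187 p hp
  · exact level_nine_poly_cube_188 p hp
  · exact level_nine_poly_cube_189 p hp
  · exact level_nine_poly_cube_190 p hp
  · exact level_nine_poly_cube_191 p hp
  · exact level_nine_poly_cube_192 p hp
  · exact level_nine_poly_cube_193 p hp
  · exact level_nine_poly_cube_194 p hp
  · exact level_nine_poly_cube_195 p hp
  · exact level_nine_poly_cube_196 p hp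
  · exact level_nine_poly_cube_197 p hp
  · exact level_nine_poly_cube_198 p hp
  · exact level_nine_poly_cube_199 p hp
  · exact level_nine_poly_cube_200 p hp
  · exact level_nine_poly_cube_201 p hp
  · exact level_nine_poly_cube_202 p hp
  · exact level_nine_poly_cube_203 p hp
  · exact level_nine_poly_cube_204 p hp
  · exact level_nine_poly_cube_205 p hp
  · exact level_nine_poly_cube_206 p hp
  · exact level_nine_poly_cube_207 p hp
  · exact level_nine_poly_cube_208 p hp
  · exact level_nine_poly_cube_209 p hp
  · exact level_nine_poly_cube_210 p hp
  · exact level_nine_poly_cube_211 p hp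
  · exact level_nine_poly_cube_212 p hp
  · exact level_nine_poly_cube_213 p hp
  · exact level_nine_poly_cube_214 p hp
  · exact level_nine_poly_cube_215 p hp
  · exact level_nine_poly_cube_216 p hp
  · exact level_nine_poly_cube_217 p hp
  · exact level_nine_poly_cube_218 p hp
  · exact level_nine_poly_cube_219 p hp
  · exact level_nine_poly_cube_220 p hp
  · exact level_nine_poly_cube_221 p hp
  · exact level_nine_poly_cube_222 p hp
  · exact level_nine_poly_cube_223 p hp
  · exact level_nine_poly_cube_224 p hp
  · exact level_nine_poly_cube_225 p hp
  · exact level_nine_poly_cube_226 p hp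
  · exact level_nine_poly_cube_227 p hp
  · exact level_nine_poly_cube_228 p hp
  · exact level_nine_poly_cube_229 p hp
  · exact level_nine_poly_cube_230 p hp
  · exact level_nine_poly_cube_231 p hp
  · exact level_nine_poly_cube_232 p hp
  · exact level_nine_poly_cube_233 p hp
  · exact level_nine_poly_cube_234 p hp
  · exact level_nine_poly_cube_235 p hp
  · exact level_nine_poly_cube_236 p hp
  · exact level_nine_poly_cube_237 p hp
  · exact level_nine_poly_cube_238 p hp
  · exact level_nine_poly_cube_239 p hp
  · exact level_nine_poly_cube_240 p hp
  · exact level_nine_poly_cube_241 p hp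
  · exact level_nine_poly_cube_242 p hp
  · exact level_nine_poly_cube_243 p hp
  · exact level_nine_poly_cube_244 p hp
  · exact level_nine_poly_cube_245 p hp
  · exact level_nine_poly_cube_246 p hp
  · exact level_nine_poly_cube_247 p hp
  · exact level_nine_poly_cube_248 p hp
  · exact level_nine_poly_cube_249 p hp

end ThmN

end PercRepro
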